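import Literature.NumberTheory.Weil1964.UnitaryArchSingularCentralizerTopFormHaarInvariance
import Literature.NumberTheory.Rogawski1990.TransferFactsCanonical
import HarnessLib

/-!
# The top-form singular orbital-measure family on `U(H)(L⁺ ⊗ ℝ)` (Rogawski 1990 §1.7 p. 6 «compatible measures», §4.3 (4.3.1) p. 43; Deitmar–Echterhoff Thm. 1.5.3)

Topic `NumberTheory/Weil1964`; namespace `Literature.NumberTheory.Weil1964.UnitaryArchTopForm`.  ONE DEFINITION WITH BODY + its `rfl` unfolding (statement lane); no theorem
beyond `rfl`, no instance, no notation, no named fact (net debt 0), no `sorry`.  Cell `pub/hodgecm-mathlib`, crux H413 = `stmt-HodgeConjecture-24833`; D-T road row «D-T3′»,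
brick B2e: the NAMED archimedean witness for the Weil-quotient rider (Q-∞) of ★ `Rogawski1990.TamagawaSingularMembersExist` on the FRAMED singular classes — at a class `c`
whose representative `out c` admits a singular archimedean frame (★ B2a `IsSingularArchFrame`), the member is the Weil quotient `dν ∕ d(centralizerTopFormHaar (out c))`
(★ `Literature.MeasureTheory.Group.quotientMeasure`; the centraliser datum is Haar ★ B2b and inversion invariant ★ B2e-1); elsewhere the junk `0` (never read: the riders
and the relative identity (K7-s) quantify over guarded classes only).  Its `IsQuotientOf` property and the point reading on the nose are the sibling theorems module
`UnitaryArchSingularTopFormFamilyQuotient`.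

* **`archSingularTopFormFamily L H ν : OrbitalMeasureFamily (U(H)(L⁺ ⊗ ℝ))`**, `archSingularTopFormFamily_apply` (`rfl`).
HONEST SCOPE.  A definition; HC_CM is proved only modulo the printed citations until rung 0 closes.  The guard «framed» contains every `γ₀ ⊗ 1` (`γ₀` singular semisimple
non-scalar rational, ★ B2c) and its `U(H)(L⁺ ⊗ ℝ)`-conjugates, NOT the `GL₃`-stable conjugates with other block signatures.

## References
* J. D. Rogawski, *Automorphic Representations of Unitary Groups in Three Variables*, Ann. of Math. Stud. 123 (1990), §1.7 p. 6, §4.3 (4.3.1) p. 43. [Rogawski1990]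
* A. Deitmar, S. Echterhoff, *Principles of Harmonic Analysis*, 2nd ed. (2014), Thm. 1.5.3. [DeitmarEchterhoff2014]
-/

noncomputable section

open NumberField NumberField.mixedEmbedding NumberField.InfinitePlace MeasureTheory MeasureTheory.Measure
open Literature.NumberTheory.Automorphic Literature.NumberTheory.Automorphic.UnitaryGroup Literature.NumberTheory.Rogawski1990
open Literature.MeasureTheory.Group
open scoped Classical Matrix MatrixGroups

namespace Literature.NumberTheory.Weil1964

namespace UnitaryArchTopForm

/-- **The top-form singular orbital-measure family on `U(H)(L⁺ ⊗ ℝ)`**: at a conjugacy class `c` whose representative `out c` admits a singular archimedean frame, the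
Weil quotient of `ν` by the top-form centraliser measure `centralizerTopFormHaar L H (out c)` (Haar ★ `isHaarMeasure_centralizerTopFormHaar`, inversion invariant ★
`isInvInvariant_centralizerTopFormHaar`); the junk `0` at the other classes. [cite: Rogawski1990, §1.7 p. 6; §4.3 (4.3.1) p. 43] [cite: DeitmarEchterhoff2014, Thm. 1.5.3] -/
def archSingularTopFormFamily (L : Type) [Field L] [NumberField L] [IsCMField L] (H : Matrix (Fin 3) (Fin 3) L)
    [MeasurableSpace (arch (↥(maximalRealSubfield L)) L (IsCMField.complexConj L) 3 H)] [BorelSpace (arch (↥(maximalRealSubfield L)) L (IsCMField.complexConj L) 3 H)]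
    [∀ γ : arch (↥(maximalRealSubfield L)) L (IsCMField.complexConj L) 3 H,
      MeasurableSpace (arch (↥(maximalRealSubfield L)) L (IsCMField.complexConj L) 3 H ⧸
        Subgroup.centralizer ({γ} : Set (arch (↥(maximalRealSubfield L)) L (IsCMField.complexConj L) 3 H)))]
    [∀ γ : arch (↥(maximalRealSubfield L)) L (IsCMField.complexConj L) 3 H,
      BorelSpace (arch (↥(maximalRealSubfield L)) L (IsCMField.complexConj L) 3 H ⧸
        Subgroup.centralizer ({γ} : Set (arch (↥(maximalRealSubfield L)) L (IsCMField.complexConj L) 3 H)))]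
    (ν : Measure (arch (↥(maximalRealSubfield L)) L (IsCMField.complexConj L) 3 H)) [IsFiniteMeasureOnCompacts ν] [ν.IsMulRightInvariant] :
    OrbitalMeasureFamily (arch (↥(maximalRealSubfield L)) L (IsCMField.complexConj L) 3 H) := fun c =>
  if h : ∃ (a b : L) (T : GL (Fin 3) (mixedSpace L)) (H_a : Matrix (Fin 2) (Fin 2) L) (H_b : Matrix (Fin 1) (Fin 1) L),
      IsSingularArchFrame L H (Quotient.out c) a b T H_a H_b then
    haveI := isHaarMeasure_centralizerTopFormHaar h.choose_spec.choose_spec.choose_spec.choose_spec.choose_spec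
    haveI := isInvInvariant_centralizerTopFormHaar h.choose_spec.choose_spec.choose_spec.choose_spec.choose_spec
    quotientMeasure (Subgroup.centralizer ({(Quotient.out c : arch (↥(maximalRealSubfield L)) L (IsCMField.complexConj L) 3 H)} :
        Set (arch (↥(maximalRealSubfield L)) L (IsCMField.complexConj L) 3 H)))
      (centralizerTopFormHaar L H (Quotient.out c)) (isClosed_coe_centralizer_singleton (Quotient.out c)) ν
  else 0

/-- Unfolding of `archSingularTopFormFamily` (definitional). [cite: Rogawski1990, §4.3 (4.3.1) p. 43] -/
theorem archSingularTopFormFamily_apply (L : Type) [Field L] [NumberField L] [IsCMField L] (H : Matrix (Fin 3) (Fin 3) L)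
    [MeasurableSpace (arch (↥(maximalRealSubfield L)) L (IsCMField.complexConj L) 3 H)] [BorelSpace (arch (↥(maximalRealSubfield L)) L (IsCMField.complexConj L) 3 H)]
    [∀ γ : arch (↥(maximalRealSubfield L)) L (IsCMField.complexConj L) 3 H,
      MeasurableSpace (arch (↥(maximalRealSubfield L)) L (IsCMField.complexConj L) 3 H ⧸
        Subgroup.centralizer ({γ} : Set (arch (↥(maximalRealSubfield L)) L (IsCMField.complexConj L) 3 H)))]
    [∀ γ : arch (↥(maximalRealSubfield L)) L (IsCMField.complexConj L) 3 H,
      BorelSpace (arch (↥(maximalRealSubfield L)) L (IsCMField.complexConj L) 3 H ⧸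
        Subgroup.centralizer ({γ} : Set (arch (↥(maximalRealSubfield L)) L (IsCMField.complexConj L) 3 H)))]
    (ν : Measure (arch (↥(maximalRealSubfield L)) L (IsCMField.complexConj L) 3 H)) [IsFiniteMeasureOnCompacts ν] [ν.IsMulRightInvariant]
    (c : ConjClasses (arch (↥(maximalRealSubfield L)) L (IsCMField.complexConj L) 3 H)) :
    archSingularTopFormFamily L H ν c =
      if h : ∃ (a b : L) (T : GL (Fin 3) (mixedSpace L)) (H_a : Matrix (Fin 2) (Fin 2) L) (H_b : Matrix (Fin 1) (Fin 1) L),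
          IsSingularArchFrame L H (Quotient.out c) a b T H_a H_b then
        haveI := isHaarMeasure_centralizerTopFormHaar h.choose_spec.choose_spec.choose_spec.choose_spec.choose_spec
        haveI := isInvInvariant_centralizerTopFormHaar h.choose_spec.choose_spec.choose_spec.choose_spec.choose_spec
        quotientMeasure (Subgroup.centralizer ({(Quotient.out c : arch (↥(maximalRealSubfield L)) L (IsCMField.complexConj L) 3 H)} :
            Set (arch (↥(maximalRealSubfield L)) L (IsCMField.complexConj L) 3 H)))
          (centralizerTopFormHaar L H (Quotient.out c)) (isClosed_coe_centralizer_singleton (Quotient.out c)) ν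
      else 0 :=
  rfl

end UnitaryArchTopForm

end Literature.NumberTheory.Weil1964

end
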